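import Literature.Analysis.FluidPDE.HuangQinWangWei2024SelfSimilarGCLM
import Literature.Analysis.Fourier.HilbertTransformDecay
import HarnessLib

/-!
# The exactly self-similar ansatz of the gCLM on the line SOLVES the equation: dilation covariance of the
# Hilbert transform, and «profile equation ⇒ self-similar classical solution that blows up»
# (Huang–Qin–Wang–Wei 2024, §2 and Cor. 2.2 — proved here modulo a named regularity side condition)

HONEST FRAMING (cell ns-blowup GROUP B «PROFILE SEARCH», zone Z3): **1-D MODEL (gCLM/OSW), not Euler/NS.**

Analysis/FluidPDE PROOF file (NO named fact; our own proofs of cited statements). Companion of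
`Chen2020DissipativeGCLM.lean` (`lineHilbert`, `lineVelocity`, `IsGCLMLineSolution`, `SupNormBlowupBefore`)
and `HuangQinWangWei2024SelfSimilarGCLM.lean` (`GCLMProfileEqAt`, `gclmSelfSimilar`, the fact
`huangQinWangWei2024_selfSimilarProfiles`). Source of the statements: [HuangQinWangWei2024] §2, first display
("Substituting the ansatz (1.2) into the equation (1.1) yields … `c_ω = −1` and an equation for the
self-similar profile") and Corollary 2.2 ("For any `a ≤ a̲ ≈ 0.5269`, the generalized Constantin–Lax–Majda model
can develop finite-time singularity from smooth initial data"), eq. (2.3) (the `β`-scaling).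

* `HilbertPVAdmissible f` — the regularity SIDE CONDITION under which the split principal value is
  split-point independent and dilation covariant: both pieces `(f(y−w) − f(y))/w` on `(−r, r)` and `f(y−w)/w` on
  `{|w| ≥ r}` are integrable for every base point `y` and radius `r > 0` (true e.g. for `C¹` functions with
  bounded derivative lying in some `L^p`, `p < ∞`; NOT discharged here for the fact's profiles — it is an explicit
  hypothesis of every theorem below, never a fact).
* `hilbertPV_split_of_integrable` — the split point is arbitrary (the tree's `hilbertPV_split_eq` of
  `Literature/Analysis/Fourier/HilbertTransformDecay.lean` with its Lipschitz/compact-support hypotheses replaced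
  by the two integrability hypotheses it actually uses). [folklore calculus, cited to HQWW (2.2)]
* `lineHilbert_comp_mul`, `lineVelocity_comp_mul` — DILATION COVARIANCE: `H[f(β·)](x) = (Hf)(βx)` and
  `u[f(β·)](x) = β⁻¹ u[f](βx)` for `β > 0` (the `β`-part of HQWW's scaling (2.3)).
* `isGCLMLineSolution_gclmSelfSimilar` — **(P) ⇒ the ansatz is a classical solution**: if `Ω ∈ C² ∩ L¹` is
  admissible and solves `(c_l X + aU)Ω′ = (−1 + HΩ)Ω` at every `X`, then for every `T > 0`
  `ω(t,x) = (T−t)⁻¹ Ω(x/(T−t)^{c_l})` is a classical solution of the INVISCID gCLM (`IsGCLMLineSolution a 0 ω T`)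
  on `ℝ × [0,T)`; `supNormBlowupBefore_gclmSelfSimilar` — it blows up at `T` as soon as `Ω ≢ 0`
  (`|ω(t,(T−t)^{c_l}X₀)| = |Ω(X₀)|/(T−t)`). Together: HQWW Cor 2.2 in kernel form, modulo the fact (which
  supplies smooth profiles solving (P) for `a < a̲`) and the admissibility + integrability of that profile.

## What is deliberately NOT here

No discharge of `HilbertPVAdmissible`/`Integrable` for the fact's profiles (their algebraic tails
`|x|^{−1/c_l}` make both true for `0 < c_l < 1`, i.e. `a ∈ (0, a̲)`, but the extraction from the fact's `Tendsto`
clauses is not done). No viscous version (for `ν > 0` the ansatz is not exact unless `c_l = 1/2`). Nothing about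
Euler or Navier–Stokes.

## References

* D. Huang, X. Qin, X. Wang, D. Wei, Arch. Ration. Mech. Anal. 248 (2024) 22 = arXiv:2305.05895: §2 (first
  display, (2.1)–(2.3)), Cor. 2.2. [HuangQinWangWei2024]
* J. Chen, Nonlinearity 33 (2020) 2502, §2.1 (dynamic rescaling ⇔ self-similar solutions). [Chen2020DissipativeGCLM]
-/

noncomputable section

open _root_.MeasureTheory Set Filter
open scoped Real Topology

namespace Literature.Analysis.FluidPDE

/-! ### The regularity side condition and the split-point independence -/

/-- ADMISSIBILITY for the split principal value: at every base point `y` and every radius `r > 0` the near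
integrand `(f(y−w) − f(y))/w` is integrable on `(−r, r)` and the far integrand `f(y−w)/w` is integrable on
`{|w| ≥ r}`. Under it `lineHilbert f` is the principal value with ANY split radius and is dilation covariant.
(A side condition, carried as an explicit hypothesis; e.g. `C¹` with bounded derivative and `f ∈ L^p`, `p < ∞`.)
[cite: HuangQinWangWei2024, eq. (2.2) (the P.V. integral)] -/
def HilbertPVAdmissible (f : ℝ → ℝ) : Prop :=
  (∀ y r : ℝ, 0 < r → IntegrableOn (fun w => (f (y - w) - f y) / w) (Ioo (-r) r)) ∧
  (∀ y r : ℝ, 0 < r → IntegrableOn (fun w => f (y - w) / w) {w : ℝ | r ≤ |w|})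

/-- Moving the split point outwards under integrability hypotheses only: for `0 < s ≤ t`,
`∫_{(−s,s)} N + ∫_{s≤|u|} F = ∫_{(−t,t)} N + ∫_{t≤|u|} F`, `N(u) = (g(x−u)−g(x))/u`, `F(u) = g(x−u)/u` — on the
annulus the integrands differ by `g(x)·u⁻¹`, which integrates to zero. (The tree's
`Literature.Analysis.Fourier.hilbertPV_split_mono`, hypotheses weakened to what its proof uses.)
[cite: HuangQinWangWei2024, eq. (2.2)] -/
theorem hilbertPV_split_of_integrable {g : ℝ → ℝ} {x s t : ℝ} (hs : 0 < s) (hst : s ≤ t)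
    (hN : IntegrableOn (fun u => (g (x - u) - g x) / u) (Ioo (-t) t))
    (hF : IntegrableOn (fun u => g (x - u) / u) {u : ℝ | s ≤ |u|}) :
    (∫ u in Ioo (-s) s, (g (x - u) - g x) / u) + ∫ u in {u : ℝ | s ≤ |u|}, g (x - u) / u =
      (∫ u in Ioo (-t) t, (g (x - u) - g x) / u) + ∫ u in {u : ℝ | t ≤ |u|}, g (x - u) / u := by
  set A : Set ℝ := {u : ℝ | s ≤ |u| ∧ |u| < t} with hA
  have hAm : MeasurableSet A := Literature.Analysis.Fourier.measurableSet_annulus s t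
  have hset1 : Ioo (-t) t = Ioo (-s) s ∪ A := by
    ext u
    simp only [mem_Ioo, mem_union, hA, mem_setOf_eq, ← abs_lt]
    constructor
    · intro h
      rcases lt_or_ge |u| s with h' | h'
      · exact Or.inl h'
      · exact Or.inr ⟨h', h⟩
    · rintro (h | ⟨-, h⟩)
      · exact h.trans_le hst
      · exact h
  have hdisj1 : Disjoint (Ioo (-s) s) A := by
    rw [Set.disjoint_left]
    intro u hu huA
    rw [mem_Ioo, ← abs_lt] at hu
    exact absurd huA.1 (not_le.2 hu)
  have hset2 : {u : ℝ | s ≤ |u|} = A ∪ {u : ℝ | t ≤ |u|} := by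
    ext u
    simp only [mem_setOf_eq, mem_union, hA]
    constructor
    · intro h
      rcases lt_or_ge |u| t with h' | h'
      · exact Or.inl ⟨h, h'⟩
      · exact Or.inr h'
    · rintro (⟨h, -⟩ | h)
      · exact h
      · exact hst.trans h
  have hdisj2 : Disjoint A {u : ℝ | t ≤ |u|} := by
    rw [Set.disjoint_left]
    intro u huA hu
    exact absurd huA.2 (not_lt.2 hu)
  have hNs : IntegrableOn (fun u => (g (x - u) - g x) / u) (Ioo (-s) s) :=
    hN.mono_set (Ioo_subset_Ioo (by linarith) hst)
  have hNA : IntegrableOn (fun u => (g (x - u) - g x) / u) A := hN.mono_set (hset1 ▸ subset_union_right)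
  have hFA : IntegrableOn (fun u => g (x - u) / u) A := hF.mono_set (hset2 ▸ subset_union_left)
  have hFt : IntegrableOn (fun u => g (x - u) / u) {u : ℝ | t ≤ |u|} :=
    hF.mono_set (hset2 ▸ subset_union_right)
  have hinvA : IntegrableOn (fun u : ℝ => u⁻¹) A := by
    refine Measure.integrableOn_of_bounded (M := s⁻¹)
      (Literature.Analysis.Fourier.volume_annulus_lt_top s t).ne measurable_inv.aestronglyMeasurable ?_
    refine (ae_restrict_iff' hAm).2 (ae_of_all _ fun u hu => ?_)
    rw [norm_inv, Real.norm_eq_abs]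
    exact inv_anti₀ hs hu.1
  have hkey : ∫ u in A, (g (x - u) - g x) / u = ∫ u in A, g (x - u) / u := by
    have h1 : ∫ u in A, (g (x - u) - g x) / u = ∫ u in A, (g (x - u) / u - g x * u⁻¹) :=
      integral_congr_ae (ae_of_all _ fun u => by ring)
    rw [h1, integral_sub hFA (hinvA.const_mul _), integral_const_mul,
      Literature.Analysis.Fourier.setIntegral_annulus_inv_eq_zero hs, mul_zero, sub_zero]
  rw [hset1, hset2, setIntegral_union hdisj1 hAm hNs hNA,
    setIntegral_union hdisj2 (Literature.Analysis.Fourier.measurableSet_le_abs t) hFA hFt, hkey]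
  ring

/-- The split radius of `lineHilbert` is arbitrary for admissible `f`:
`π·Hf(y) = ∫_{(−r,r)} (f(y−w)−f(y))/w + ∫_{|w|≥r} f(y−w)/w` for every `r > 0`. [cite: HuangQinWangWei2024, eq. (2.2)] -/
theorem lineHilbert_eq_split {f : ℝ → ℝ} (hf : HilbertPVAdmissible f) {r : ℝ} (hr : 0 < r) (y : ℝ) :
    lineHilbert f y =
      π⁻¹ * ((∫ w in Ioo (-r) r, (f (y - w) - f y) / w) + ∫ w in {w : ℝ | r ≤ |w|}, f (y - w) / w) := by
  rw [lineHilbert_def]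
  congr 1
  rcases le_or_gt r 1 with h | h
  · exact (hilbertPV_split_of_integrable hr h (hf.1 y 1 one_pos) (hf.2 y r hr)).symm
  · exact hilbertPV_split_of_integrable one_pos h.le (hf.1 y r hr) (hf.2 y 1 one_pos)

/-! ### Dilation covariance of `H` and of the velocity -/

/-- Change of variables `w = βu` in a set integral over a measurable set `S`, `β > 0`:
`∫_{u ∈ β⁻¹S} β·K(βu) du = ∫_{w ∈ S} K(w) dw`, phrased with the preimage predicate. [folklore] -/
private theorem setIntegral_comp_mul_of_pos {S : Set ℝ} (hS : MeasurableSet S) {β : ℝ} (hβ : 0 < β)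
    (K : ℝ → ℝ) {S' : Set ℝ} (hS' : MeasurableSet S') (hpre : ∀ u, u ∈ S' ↔ β * u ∈ S)
    (G : ℝ → ℝ) (hG : ∀ u ∈ S', G u = β * K (β * u)) :
    ∫ u in S', G u = ∫ w in S, K w := by
  have hind : S'.indicator G = fun u => S.indicator (fun w => β * K w) (β * u) := by
    funext u
    by_cases hu : u ∈ S'
    · have hβu : β * u ∈ S := (hpre u).1 hu
      simp [Set.indicator, hu, hβu, hG u hu]
    · have hβu : β * u ∉ S := fun h => hu ((hpre u).2 h)
      simp [Set.indicator, hu, hβu]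
  rw [← integral_indicator hS', hind, Measure.integral_comp_mul_left (fun w => S.indicator (fun w => β * K w) w) β,
    integral_indicator hS]
  rw [integral_const_mul, smul_eq_mul, abs_of_pos (inv_pos.2 hβ), ← mul_assoc, inv_mul_cancel₀ hβ.ne',
    one_mul]

/-- **Dilation covariance of the Hilbert transform**: `H[f(β·)](x) = (Hf)(βx)` for `β > 0` and admissible `f`
(both pieces rescale by `w = βu`; the split radius becomes `β` and is moved back to `1`).
[cite: HuangQinWangWei2024, eq. (2.3) (the `β`-scaling)] -/
theorem lineHilbert_comp_mul {f : ℝ → ℝ} (hf : HilbertPVAdmissible f) {β : ℝ} (hβ : 0 < β) (x : ℝ) :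
    lineHilbert (fun y => f (β * y)) x = lineHilbert f (β * x) := by
  rw [lineHilbert_def, lineHilbert_eq_split hf hβ (β * x)]
  congr 1
  have hA : ∫ u in Ioo (-1 : ℝ) 1, (f (β * (x - u)) - f (β * x)) / u =
      ∫ w in Ioo (-β) β, (f (β * x - w) - f (β * x)) / w := by
    refine setIntegral_comp_mul_of_pos measurableSet_Ioo hβ (fun w => (f (β * x - w) - f (β * x)) / w)
      measurableSet_Ioo (fun u => ?_) _ (fun u hu => ?_)
    · simp only [mem_Ioo]
      constructor
      · rintro ⟨h1, h2⟩; constructor <;> nlinarith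
      · rintro ⟨h1, h2⟩; constructor <;> nlinarith
    · by_cases hu0 : u = 0
      · subst hu0; simp
      · rw [mul_sub]
        field_simp
  have hB : ∫ u in {u : ℝ | 1 ≤ |u|}, f (β * (x - u)) / u = ∫ w in {w : ℝ | β ≤ |w|}, f (β * x - w) / w := by
    refine setIntegral_comp_mul_of_pos (Literature.Analysis.Fourier.measurableSet_le_abs β) hβ
      (fun w => f (β * x - w) / w) (Literature.Analysis.Fourier.measurableSet_le_abs 1) (fun u => ?_) _
      (fun u hu => ?_)
    · simp only [mem_setOf_eq, abs_mul, abs_of_pos hβ]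
      constructor
      · intro h; nlinarith
      · intro h; nlinarith
    · have hu0 : u ≠ 0 := by
        intro h0; simp only [mem_setOf_eq, h0, abs_zero] at hu; linarith
      rw [mul_sub]
      field_simp
  rw [hA, hB]

/-- **Dilation of the velocity**: `u[f(β·)](x) = β⁻¹·u[f](βx)` for `β > 0` and admissible `f`
(`∫₀ˣ (Hf)(βy) dy = β⁻¹ ∫₀^{βx} Hf`). [cite: HuangQinWangWei2024, eq. (2.3)] -/
theorem lineVelocity_comp_mul {f : ℝ → ℝ} (hf : HilbertPVAdmissible f) {β : ℝ} (hβ : 0 < β) (x : ℝ) :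
    lineVelocity (fun y => f (β * y)) x = β⁻¹ * lineVelocity f (β * x) := by
  rw [lineVelocity_def, lineVelocity_def]
  have : (fun y => lineHilbert (fun z => f (β * z)) y) = fun y => lineHilbert f (β * y) :=
    funext fun y => lineHilbert_comp_mul hf hβ y
  rw [this, intervalIntegral.integral_comp_mul_left (fun y => lineHilbert f y) hβ.ne', mul_zero, smul_eq_mul]

/-! ### The ansatz solves the inviscid gCLM and blows up -/

section Ansatz

variable {a cl T : ℝ} {Ω : ℝ → ℝ}

/-- The slice of the ansatz at time `t < T` is the dilated, rescaled profile
`x ↦ (T−t)⁻¹ · Ω((T−t)^{−c_l} · x)`. [cite: HuangQinWangWei2024, eq. (1.2)] -/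
theorem gclmSelfSimilar_slice (t : ℝ) :
    gclmSelfSimilar (-1) cl T Ω t = fun x => (T - t)⁻¹ * Ω (((T - t) ^ cl)⁻¹ * x) := by
  funext x
  rw [gclmSelfSimilar_def, Real.rpow_neg_one, div_eq_inv_mul]

/-- Space derivative of the slice: `ω_x(t,x) = (T−t)⁻¹ (T−t)^{−c_l} Ω′(X)`, `X = x/(T−t)^{c_l}`.
[cite: HuangQinWangWei2024, §2 (substitution of the ansatz)] -/
theorem deriv_gclmSelfSimilar_slice (t : ℝ) (hΩ : Differentiable ℝ Ω) (x : ℝ) :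
    deriv (gclmSelfSimilar (-1) cl T Ω t) x =
      (T - t)⁻¹ * (((T - t) ^ cl)⁻¹ * deriv Ω (((T - t) ^ cl)⁻¹ * x)) := by
  rw [gclmSelfSimilar_slice t]
  set L : ℝ := (T - t) ^ cl with hL
  have h1 : HasDerivAt (fun y : ℝ => L⁻¹ * y) (L⁻¹ * 1) x := (hasDerivAt_id x).const_mul L⁻¹
  have h2 : HasDerivAt (fun y : ℝ => Ω (L⁻¹ * y)) (deriv Ω (L⁻¹ * x) * (L⁻¹ * 1)) x :=
    ((hΩ (L⁻¹ * x)).hasDerivAt).comp x h1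
  have h3 := h2.const_mul (T - t)⁻¹
  rw [h3.deriv]
  ring

/-- Hilbert transform of the slice: `H[ω(t,·)](x) = (T−t)⁻¹ (HΩ)(X)`. [cite: HuangQinWangWei2024, §2] -/
theorem lineHilbert_gclmSelfSimilar_slice {t : ℝ} (ht : t < T) (hadm : HilbertPVAdmissible Ω) (x : ℝ) :
    lineHilbert (gclmSelfSimilar (-1) cl T Ω t) x =
      (T - t)⁻¹ * lineHilbert Ω (((T - t) ^ cl)⁻¹ * x) := by
  have hτ : 0 < T - t := sub_pos.2 ht
  have hL : 0 < ((T - t) ^ cl)⁻¹ := inv_pos.2 (Real.rpow_pos_of_pos hτ cl)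
  rw [gclmSelfSimilar_slice t, lineHilbert_const_mul, lineHilbert_comp_mul hadm hL]

/-- Velocity of the slice: `u[ω(t,·)](x) = (T−t)⁻¹ (T−t)^{c_l} U(X)`. [cite: HuangQinWangWei2024, §2] -/
theorem lineVelocity_gclmSelfSimilar_slice {t : ℝ} (ht : t < T) (hadm : HilbertPVAdmissible Ω) (x : ℝ) :
    lineVelocity (gclmSelfSimilar (-1) cl T Ω t) x =
      (T - t)⁻¹ * ((T - t) ^ cl * lineVelocity Ω (((T - t) ^ cl)⁻¹ * x)) := by
  have hτ : 0 < T - t := sub_pos.2 ht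
  have hLpos : 0 < (T - t) ^ cl := Real.rpow_pos_of_pos hτ cl
  have hL : 0 < ((T - t) ^ cl)⁻¹ := inv_pos.2 hLpos
  rw [gclmSelfSimilar_slice t, lineVelocity_const_mul, lineVelocity_comp_mul hadm hL, inv_inv]

/-- Time derivative of the ansatz at `t < T`:
`∂_t ω(t,x) = (T−t)⁻² (Ω(X) + c_l X Ω′(X))`, `X = x/(T−t)^{c_l}`. [cite: HuangQinWangWei2024, §2 (first display)] -/
theorem hasDerivAt_gclmSelfSimilar_time {t : ℝ} (ht : t < T) (hΩ : Differentiable ℝ Ω) (x : ℝ) :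
    HasDerivAt (fun s => gclmSelfSimilar (-1) cl T Ω s x)
      ((T - t)⁻¹ ^ 2 * (Ω (((T - t) ^ cl)⁻¹ * x) +
        cl * (((T - t) ^ cl)⁻¹ * x) * deriv Ω (((T - t) ^ cl)⁻¹ * x))) t := by
  have hτ : 0 < T - t := sub_pos.2 ht
  have hτ0 : T - t ≠ 0 := hτ.ne'
  set L : ℝ := (T - t) ^ cl with hLdef
  have hLpos : 0 < L := Real.rpow_pos_of_pos hτ cl
  have hL0 : L ≠ 0 := hLpos.ne'
  -- s ↦ T - s
  have hsub : HasDerivAt (fun s : ℝ => T - s) (-1) t := by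
    simpa using (hasDerivAt_id t).const_sub T
  -- s ↦ (T - s) ^ (-1)
  have hA : HasDerivAt (fun s : ℝ => (T - s) ^ (-1 : ℝ)) ((-1) * (-1) * (T - t) ^ ((-1 : ℝ) - 1)) t :=
    hsub.rpow_const (Or.inl hτ0)
  -- s ↦ (T - s) ^ cl and its inverse times x
  have hLd : HasDerivAt (fun s : ℝ => (T - s) ^ cl) ((-1) * cl * (T - t) ^ (cl - 1)) t :=
    hsub.rpow_const (Or.inl hτ0)
  have hLinv : HasDerivAt (fun s : ℝ => ((T - s) ^ cl)⁻¹)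
      (-((-1) * cl * (T - t) ^ (cl - 1)) / ((T - t) ^ cl) ^ 2) t := hLd.inv hL0
  have hX : HasDerivAt (fun s : ℝ => x / (T - s) ^ cl)
      (x * (-((-1) * cl * (T - t) ^ (cl - 1)) / ((T - t) ^ cl) ^ 2)) t := by
    have := hLinv.const_mul x
    refine this.congr_of_eventuallyEq ?_
    exact Filter.Eventually.of_forall fun s => by simp [div_eq_mul_inv]
  have hΩX : HasDerivAt (fun s : ℝ => Ω (x / (T - s) ^ cl))
      (deriv Ω (x / (T - t) ^ cl) * (x * (-((-1) * cl * (T - t) ^ (cl - 1)) / ((T - t) ^ cl) ^ 2))) t :=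
    ((hΩ _).hasDerivAt).comp t hX
  have hprod := hA.mul hΩX
  -- identify the function and the derivative value
  have hprod' : HasDerivAt (fun s => gclmSelfSimilar (-1) cl T Ω s x)
      ((-1) * (-1) * (T - t) ^ ((-1 : ℝ) - 1) * Ω (x / (T - t) ^ cl) +
        (T - t) ^ (-1 : ℝ) * (deriv Ω (x / (T - t) ^ cl) *
          (x * (-((-1) * cl * (T - t) ^ (cl - 1)) / ((T - t) ^ cl) ^ 2)))) t :=
    hprod.congr_of_eventuallyEq (Filter.Eventually.of_forall fun s => by
      simp only [Pi.mul_apply, gclmSelfSimilar_def])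
  refine hprod'.congr_deriv ?_
  have h1 : (T - t) ^ ((-1 : ℝ) - 1) = ((T - t) ^ 2)⁻¹ := by
    rw [show ((-1 : ℝ) - 1) = -(2 : ℝ) by norm_num, Real.rpow_neg hτ.le, Real.rpow_two]
  have h2 : (T - t) ^ (cl - 1) = L / (T - t) := Real.rpow_sub_one hτ0 cl
  have h3 : (T - t) ^ (-1 : ℝ) = (T - t)⁻¹ := Real.rpow_neg_one _
  have h4 : x / (T - t) ^ cl = L⁻¹ * x := by rw [div_eq_inv_mul]
  rw [h1, h2, h3, h4]
  field_simp
  ring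

/-- **(P) ⇒ the exactly self-similar ansatz is a classical solution of the inviscid gCLM** on `ℝ × [0,T)`, for
every `T > 0`: if `Ω ∈ C² ∩ L¹(ℝ)` is admissible (`HilbertPVAdmissible Ω`) and solves the profile equation
`(c_l X + aU)Ω′ = (−1 + HΩ)Ω` at every `X`, then `ω(t,x) = (T−t)⁻¹Ω(x/(T−t)^{c_l})` satisfies
`IsGCLMLineSolution a 0 ω T`. (HQWW §2: "Substituting the ansatz (1.2) into the equation (1.1) yields …",
read backwards; the dilation covariance of `H` supplies `u(t,x) = (T−t)^{c_l−1}U(X)`, `Hω(t,x) = (T−t)⁻¹HΩ(X)`.)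
[cite: HuangQinWangWei2024, §2 (first display) and Cor. 2.2] -/
theorem isGCLMLineSolution_gclmSelfSimilar (hT : 0 < T) (hΩ2 : ContDiff ℝ 2 Ω) (hΩi : Integrable Ω)
    (hadm : HilbertPVAdmissible Ω) (hP : ∀ X : ℝ, GCLMProfileEqAt a cl (-1) Ω X) :
    IsGCLMLineSolution a 0 (gclmSelfSimilar (-1) cl T Ω) T := by
  have hΩd : Differentiable ℝ Ω := hΩ2.differentiable (by norm_num)
  have hΩc : Continuous Ω := hΩ2.continuous
  refine ⟨fun t ht => ?_, fun x => ?_, fun t ht x => ?_⟩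
  · -- slices are C² and integrable
    have htT : t < T := ht.2
    have hτ : 0 < T - t := sub_pos.2 htT
    have hL0 : (T - t) ^ cl ≠ 0 := (Real.rpow_pos_of_pos hτ cl).ne'
    rw [gclmSelfSimilar_slice t]
    refine ⟨contDiff_const.mul (hΩ2.comp (contDiff_const.mul contDiff_id)), ?_⟩
    exact (hΩi.comp_mul_left' (inv_ne_zero hL0)).const_mul _
  · -- the datum is attained: continuity of the formula at t = 0 < T
    refine ContinuousAt.continuousWithinAt ?_
    have h0 : T - 0 ≠ 0 := by simpa using hT.ne'
    have hsub : Continuous fun s : ℝ => T - s := continuous_const.sub continuous_id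
    have hA : ContinuousAt (fun s : ℝ => (T - s) ^ (-1 : ℝ)) 0 :=
      (Real.continuousAt_rpow_const (T - 0) (-1) (Or.inl h0)).comp hsub.continuousAt
    have hL : ContinuousAt (fun s : ℝ => (T - s) ^ cl) 0 :=
      (Real.continuousAt_rpow_const (T - 0) cl (Or.inl h0)).comp hsub.continuousAt
    have hLne : (fun s : ℝ => (T - s) ^ cl) 0 ≠ 0 := by
      simpa using (Real.rpow_pos_of_pos (by simpa using hT) cl).ne'
    have hX : ContinuousAt (fun s : ℝ => x / (T - s) ^ cl) 0 := continuousAt_const.div hL hLne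
    have hΩX : ContinuousAt (fun s : ℝ => Ω (x / (T - s) ^ cl)) 0 := hΩc.continuousAt.comp hX
    have := hA.mul hΩX
    simpa [gclmSelfSimilar_def, Pi.mul_def] using this
  · -- the equation at t ∈ (0, T)
    have htT : t < T := ht.2
    have hτ : 0 < T - t := sub_pos.2 htT
    have hτ0 : T - t ≠ 0 := hτ.ne'
    set L : ℝ := (T - t) ^ cl with hLdef
    have hLpos : 0 < L := Real.rpow_pos_of_pos hτ cl
    have hL0 : L ≠ 0 := hLpos.ne'
    have hder := hasDerivAt_gclmSelfSimilar_time (cl := cl) htT hΩd x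
    refine hder.congr_deriv ?_
    rw [deriv_gclmSelfSimilar_slice t hΩd, lineHilbert_gclmSelfSimilar_slice htT hadm,
      lineVelocity_gclmSelfSimilar_slice htT hadm, zero_mul, add_zero]
    have hslice : gclmSelfSimilar (-1) cl T Ω t x = (T - t)⁻¹ * Ω (L⁻¹ * x) := by
      rw [gclmSelfSimilar_slice t]
    rw [hslice]
    have hPX := hP (L⁻¹ * x)
    rw [gclmProfileEqAt_iff] at hPX
    -- (P): (cl X + a U) Ω' = (-1 + HΩ) Ω  ⇒  -a U Ω' + HΩ Ω = Ω + cl X Ω'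
    have key : -(a * lineVelocity Ω (L⁻¹ * x)) * deriv Ω (L⁻¹ * x) +
        lineHilbert Ω (L⁻¹ * x) * Ω (L⁻¹ * x) =
        Ω (L⁻¹ * x) + cl * (L⁻¹ * x) * deriv Ω (L⁻¹ * x) := by
      linear_combination (-1 : ℝ) * hPX
    have : (T - t)⁻¹ ^ 2 * (Ω (L⁻¹ * x) + cl * (L⁻¹ * x) * deriv Ω (L⁻¹ * x)) =
        (T - t)⁻¹ ^ 2 * (-(a * lineVelocity Ω (L⁻¹ * x)) * deriv Ω (L⁻¹ * x) +
          lineHilbert Ω (L⁻¹ * x) * Ω (L⁻¹ * x)) := by rw [key]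
    rw [this]
    field_simp
    ring

/-- The ansatz BLOWS UP at `T` in sup norm as soon as the profile is not identically zero:
`|ω(t, (T−t)^{c_l}X₀)| = |Ω(X₀)|/(T−t) → ∞`. [cite: HuangQinWangWei2024, §1 ("self-similar finite-time blowup")] -/
theorem supNormBlowupBefore_gclmSelfSimilar (hT : 0 < T) {X₀ : ℝ} (hX₀ : Ω X₀ ≠ 0) :
    SupNormBlowupBefore (gclmSelfSimilar (-1) cl T Ω) T := by
  intro M
  have hΩpos : 0 < |Ω X₀| := abs_pos.2 hX₀
  -- choose t ∈ [0,T) with T - t ≤ min T (|Ω X₀| / (|M| + 1))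
  set δ : ℝ := min T (|Ω X₀| / (|M| + 1)) with hδ
  have hM1 : 0 < |M| + 1 := by positivity
  have hδpos : 0 < δ := lt_min hT (div_pos hΩpos hM1)
  have hδT : δ ≤ T := min_le_left _ _
  refine ⟨T - δ, ⟨by linarith, by linarith⟩, (T - (T - δ)) ^ cl * X₀, ?_⟩
  have ht : T - δ < T := by linarith
  rw [abs_gclmSelfSimilar_neg_one ht Ω X₀, show T - (T - δ) = δ by ring]
  have hδle : δ ≤ |Ω X₀| / (|M| + 1) := min_le_right _ _
  have hMlt : M < |M| + 1 := by linarith [le_abs_self M]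
  calc M < |M| + 1 := hMlt
    _ ≤ |Ω X₀| / δ := by
        rw [le_div_iff₀ hδpos]
        calc (|M| + 1) * δ ≤ (|M| + 1) * (|Ω X₀| / (|M| + 1)) :=
              mul_le_mul_of_nonneg_left hδle hM1.le
          _ = |Ω X₀| := by field_simp

/-- **HQWW Corollary 2.2 in kernel form, modulo the profile's regularity**: a `C² ∩ L¹`, admissible, not
identically zero solution of the profile equation with `c_ω = −1` yields, for every `T > 0`, a classical solution
of the inviscid gCLM on `ℝ × [0,T)` with smooth datum `x ↦ T⁻¹Ω(x/T^{c_l})` whose sup norm blows up at `T` —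
exactly self-similar finite-time blow-up. (The fact `huangQinWangWei2024_selfSimilarProfiles` supplies smooth
profiles solving (P) everywhere for `a < a̲`; their admissibility/integrability is the remaining side condition.)
[cite: HuangQinWangWei2024, Cor. 2.2] -/
theorem exact_selfSimilar_blowup_of_profile (hT : 0 < T) (hΩ2 : ContDiff ℝ 2 Ω) (hΩi : Integrable Ω)
    (hadm : HilbertPVAdmissible Ω) (hP : ∀ X : ℝ, GCLMProfileEqAt a cl (-1) Ω X) {X₀ : ℝ} (hX₀ : Ω X₀ ≠ 0) :
    IsGCLMLineSolution a 0 (gclmSelfSimilar (-1) cl T Ω) T ∧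
      SupNormBlowupBefore (gclmSelfSimilar (-1) cl T Ω) T :=
  ⟨isGCLMLineSolution_gclmSelfSimilar hT hΩ2 hΩi hadm hP, supNormBlowupBefore_gclmSelfSimilar hT hX₀⟩

end Ansatz

end Literature.Analysis.FluidPDE
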